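import Literature.MathematicalPhysics.QuantumFieldTheory.Balaban1983to89.B6BlockDecayCalculus

/-!
# `Balaban1983to89.B6L2BlockCalculus` — T. Bałaban, *Propagators and renormalization transformations for lattice gauge theories. II*,
# Commun. Math. Phys. **96** (1984) 223–250 [Balaban1984PropagatorsII], Prop. 2.5 p. 246 (undisplayed step «(2.129) ⇒ (1.114)»):
# the `ℓ²` BLOCK CALCULUS — operators between `ℓ²` spaces fibred over the unit lattice whose blocks `χ_y f χ_{y′}` have operator norms
# `≤ C·e^{−δ|y−y′|}` compose, add, pass to adjoints, arise from two-sided block row-sum bounds (Schur), and give the localized `ℓ²` shape of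
# (1.114) — the tool for the two-derivative members `‖ζ∇G∇*J‖`, `‖ζ∇∇GJ‖`, `‖ζG∇*∇*J‖` of Prop. 2.5 for the two-scale `G`

statement-level skeleton of published theorems with citation tags; proofs where landed; nothing here is a claim about the Yang–Mills mass gap

[4] = *Propagators … I*, CMP **95** (1984) 17–40 [Balaban1984PropagatorsI], Prop. 1.2 (1.114) p. 36: *"Finally there exists a constant O(1) such that
‖ζGJ‖, ‖ζ∇GJ‖, ‖ζG∇*J‖, ‖ζ∇G∇*J‖, ‖ζ∇∇GJ‖, ‖ζG∇*∇*J‖ ≤ O(1)e^{−δ₀|y−y′|}|ζ|‖J‖ (1.114) for supp ζ ⊂ Δ̃(y), supp J ⊂ Δ̃(y′)."*; [B6] p. 246: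
*"… satisfies all the inequalities (1.110)–(1.114) of the Proposition 1.2 with a positive constant δ₂ instead of δ₀."*

CITATION HEADER (lean-in-tree rule) — WHAT IS REPRODUCED.  Phase-2 file of the `lit-balaban` typed skeleton (HOME `run/shared/lean/pub/lit-balaban/`),
seat **p22 gen 16**, lane B6 §C (fold owner r03, referee ref-4); SKELETON row **B6.Prop2.5** (cells only).  The `ℓ²` companion of file 2
(`…B6BlockDecayCalculus`, the `ℓ^∞`/row-sum block calculus behind the sup members (1.110)): the two-derivative members of (1.114) for the two-scale
`G` of (2.90) cannot be reached by row-sum bounds (the kernels of `∇G∇*`, `∇∇G` are of Calderón–Zygmund type) but by composing (2.129) in the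
`ℓ²`-BLOCK sense, with [4]'s own (1.114) members for `G_j` as the singular input (sequel files).  THIS FILE, abstract and definition-free (the
bound is written out as the hypothesis shape *"for `v` supported over the fibre of `y` and `u` over the fibre of `y′`, `|⟨v, fu⟩| ≤ C·e^{−δρ(y,y′)}‖v‖‖u‖`"*):
§1 **`l2blk_of_blockBounds`** — block row-sum bounds `(C_f, δ)` of `f` and `(C_g, δ)` of `f*` give the `ℓ²` block bound `(C, δ)` for every `C ≥ 0`
with `C_fC_g ≤ C²` (the Schur test on one block pair; gen 13's `…B6SchurTorusBound.sum_sq_le_abs`); §2 **`l2blk_comp`** (composition, no volume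
factor: `(C_fC_gK(a − δ′), δ′)`), `l2blk_adjoint`, `l2blk_add/sub/smul/mono/id`; §3 **`abs_inner_le_of_l2blk_balls`** (`ℓ²` block bound ⇒ the
bound `C·K(1)e^{(1+2δ)r}·e^{−δρ(y,y′)}‖v‖‖u‖` between vectors supported over the BALLS of radius `r` about `y`, `y′`) and **`normSq_cut_apply_le_of_l2blk`**
— THE SHAPE OF (1.114): for `J` supported over the points within `r` of `y′` and a cut-off `ζ` supported over those within `r` of `y`, `|ζ| ≤ Z`:
`Σ_i (ζ_i(fJ)_i)² ≤ (C·K(1)e^{(1+2δ)r}·e^{−δρ(y,y′)}·Z)²·‖J‖²`.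
IMPORTS BY NAME, restating nothing.  THEOREMS ONLY (no definition, no `def … : Prop`); standard axioms.  HONEST SCOPE: finite-dimensional bookkeeping
inequalities over an abstract pseudo-distance with a lattice-sum profile (file 2's `IsPseudoDist`/`SumBound`); no operator of the papers appears here;
constants ours; NOT summit progress.  Unit `lit-balaban-p22` (gen 16), 2026-08-22.
-/

noncomputable section

open scoped InnerProductSpace BigOperators
open Finset

namespace Literature.MathematicalPhysics.QuantumFieldTheory.Balaban1983to89.B6L2BlockCalculus

open B4Sect5Torus (IsPseudoDist SumBound)
open B6SectAOperatorsV1 (inner_eq_sum)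
open B6SchurTorusBound (sum_sq_le_abs apply_eq_sum_entry)
open B6BlockDecayCalculus (adjoint_entry conv_exp_le_rate card_ball_le)

/-! ## §0  Fibre restrictions of a vector -/

section Restrict

variable {Y : Type*} [DecidableEq Y] {κ : Type}

/-- the restriction of `x` to the fibre of `y` is supported there. [cite: Balaban1984PropagatorsI, (1.114) p.36 (bookkeeping, ours)] -/
theorem restrict_apply_of_ne (pκ : κ → Y) (x : EuclideanSpace ℝ κ) (y : Y) (k : κ) (hk : pκ k ≠ y) :
    (WithLp.toLp 2 (fun k => if pκ k = y then x k else 0) : EuclideanSpace ℝ κ) k = 0 := by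
  show (if pκ k = y then x k else 0) = 0
  rw [if_neg hk]

/-- a vector is the sum of its fibre restrictions. [cite: Balaban1984PropagatorsI, (1.114) p.36 (bookkeeping, ours)] -/
theorem sum_restrict_eq [Fintype Y] (pκ : κ → Y) (x : EuclideanSpace ℝ κ) :
    ∑ y, (WithLp.toLp 2 (fun k => if pκ k = y then x k else 0) : EuclideanSpace ℝ κ) = x := by
  apply PiLp.ext
  intro k
  rw [WithLp.ofLp_sum, Finset.sum_apply]
  show ∑ y, (if pκ k = y then x k else 0) = x k
  rw [Finset.sum_ite_eq]
  simp

/-- the squared norms of the fibre restrictions add up to the squared norm. [cite: Balaban1984PropagatorsI, (1.114) p.36 (bookkeeping, ours)] -/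
theorem sum_norm_restrict_sq [Fintype Y] [Fintype κ] (pκ : κ → Y) (x : EuclideanSpace ℝ κ) :
    ∑ y, ‖(WithLp.toLp 2 (fun k => if pκ k = y then x k else 0) : EuclideanSpace ℝ κ)‖ ^ 2 = ‖x‖ ^ 2 := by
  have h : ∀ y, ‖(WithLp.toLp 2 (fun k => if pκ k = y then x k else 0) : EuclideanSpace ℝ κ)‖ ^ 2 =
      ∑ k ∈ univ.filter (fun k => pκ k = y), (x k) ^ 2 := by
    intro y
    rw [EuclideanSpace.real_norm_sq_eq, Finset.sum_filter]
    refine Finset.sum_congr rfl fun k _ => ?_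
    show (if pκ k = y then x k else 0) ^ 2 = _
    split_ifs <;> simp
  simp_rw [h]
  rw [Finset.sum_fiberwise univ pκ (fun k => (x k) ^ 2), EuclideanSpace.real_norm_sq_eq]

/-- the restriction to the fibre of `y` of a vector supported over that fibre is the vector. [cite: Balaban1984PropagatorsI, (1.114) p.36 (bookkeeping, ours)] -/
theorem restrict_eq_self_of_support (pκ : κ → Y) (x : EuclideanSpace ℝ κ) (y : Y) (hx : ∀ k, pκ k ≠ y → x k = 0) :
    (WithLp.toLp 2 (fun k => if pκ k = y then x k else 0) : EuclideanSpace ℝ κ) = x := by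
  apply PiLp.ext
  intro k
  show (if pκ k = y then x k else 0) = x k
  by_cases hk : pκ k = y
  · rw [if_pos hk]
  · rw [if_neg hk, hx k hk]

/-- `⟨x↾y, w⟩ = ⟨x↾y, w↾y⟩`: pairing with a fibre restriction sees only that fibre. [cite: Balaban1984PropagatorsI, (1.114) p.36 (bookkeeping, ours)] -/
theorem inner_restrict_left_eq [Fintype κ] (pκ : κ → Y) (x w : EuclideanSpace ℝ κ) (y : Y) :
    ⟪(WithLp.toLp 2 (fun k => if pκ k = y then x k else 0) : EuclideanSpace ℝ κ), w⟫_ℝ =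
      ⟪(WithLp.toLp 2 (fun k => if pκ k = y then x k else 0) : EuclideanSpace ℝ κ),
        (WithLp.toLp 2 (fun k => if pκ k = y then w k else 0) : EuclideanSpace ℝ κ)⟫_ℝ := by
  rw [inner_eq_sum, inner_eq_sum]
  refine Finset.sum_congr rfl fun k _ => ?_
  show (if pκ k = y then x k else 0) * w k = (if pκ k = y then x k else 0) * (if pκ k = y then w k else 0)
  split_ifs <;> simp

end Restrict

section Blocks

variable {Y : Type*} {ρ : Y → Y → ℝ} {KY : ℝ → ℝ}
variable {ι κ μ : Type} [Fintype ι] [Fintype κ] [Fintype μ]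

/-! ## §1  The Schur test on one block pair: row block bounds of `f` and `f*` ⇒ the `ℓ²` block bound -/

/-- **BLOCK ROW-SUM BOUNDS OF `f` AND `f*` ⇒ THE `ℓ²` BLOCK BOUND**: if `Σ_{k : pκ k = y′}|f(e_k)_i| ≤ C_f e^{−δρ(pι i, y′)}` and
`Σ_{i : pι i = y}|f*(e_i)_k| ≤ C_g e^{−δρ(pκ k, y)}`, then for `v` supported over the fibre of `y`, `u` over the fibre of `y′` and every `C ≥ 0` with
`C_fC_g ≤ C²`: `|⟨v, fu⟩| ≤ C·e^{−δρ(y,y′)}‖v‖‖u‖` (Schur test for the kernel of `f` truncated to the block pair; `C = √(C_fC_g)` balances the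
fibre volumes). [cite: Balaban1984PropagatorsII, Prop. 2.5 p.246 (the «(2.129) ⇒ (1.114)» step; statement and proof ours)] -/
theorem l2blk_of_blockBounds [DecidableEq Y] [DecidableEq ι] [DecidableEq κ] (hρ : IsPseudoDist ρ) (f : EuclideanSpace ℝ κ →ₗ[ℝ] EuclideanSpace ℝ ι)
    (pι : ι → Y) (pκ : κ → Y) {Cf Cg C δ : ℝ} (hCf : 0 ≤ Cf) (hCg : 0 ≤ Cg) (hC : 0 ≤ C) (hCC : Cf * Cg ≤ C ^ 2)
    (hf : ∀ (i : ι) (y : Y), ∑ k ∈ univ.filter (fun k => pκ k = y), |f (EuclideanSpace.single k (1 : ℝ)) i| ≤ Cf * Real.exp (-(δ * ρ (pι i) y)))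
    (hg : ∀ (k : κ) (y : Y), ∑ i ∈ univ.filter (fun i => pι i = y), |LinearMap.adjoint f (EuclideanSpace.single i (1 : ℝ)) k| ≤
      Cg * Real.exp (-(δ * ρ (pκ k) y)))
    (y y' : Y) (v : EuclideanSpace ℝ ι) (u : EuclideanSpace ℝ κ) (hv : ∀ i, pι i ≠ y → v i = 0) (hu : ∀ k, pκ k ≠ y' → u k = 0) :
    |⟪v, f u⟫_ℝ| ≤ C * Real.exp (-(δ * ρ y y')) * (‖v‖ * ‖u‖) := by
  set E : ℝ := Real.exp (-(δ * ρ y y')) with hE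
  have hE0 : 0 < E := Real.exp_pos _
  -- the kernel truncated to the block pair
  set T : ι → κ → ℝ := fun i k => if pι i = y ∧ pκ k = y' then f (EuclideanSpace.single k (1 : ℝ)) i else 0 with hT
  have hTrow : ∀ i, ∑ k, |T i k| ≤ Cf * E := by
    intro i
    by_cases hi : pι i = y
    · calc ∑ k, |T i k| = ∑ k ∈ univ.filter (fun k => pκ k = y'), |f (EuclideanSpace.single k (1 : ℝ)) i| := by
            rw [Finset.sum_filter]
            refine Finset.sum_congr rfl fun k _ => ?_
            by_cases hk : pκ k = y' <;> simp [hT, hi, hk]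
        _ ≤ Cf * E := by rw [hE, ← hi]; exact hf i y'
    · have h0 : ∑ k, |T i k| = 0 := Finset.sum_eq_zero fun k _ => by simp [hT, hi]
      rw [h0]; positivity
  have hTcol : ∀ k, ∑ i, |T i k| ≤ Cg * E := by
    intro k
    by_cases hk : pκ k = y'
    · calc ∑ i, |T i k| = ∑ i ∈ univ.filter (fun i => pι i = y), |LinearMap.adjoint f (EuclideanSpace.single i (1 : ℝ)) k| := by
            rw [Finset.sum_filter]
            refine Finset.sum_congr rfl fun i _ => ?_
            by_cases hi : pι i = y <;> simp [hT, hi, hk, adjoint_entry]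
        _ ≤ Cg * E := by
            rw [hE, hρ.symm, ← hk]
            exact hg k y
    · have h0 : ∑ i, |T i k| = 0 := Finset.sum_eq_zero fun i _ => by simp [hT, hk]
      rw [h0]; positivity
  -- `(fu)_i = Σ_k T_ik u_k` on the fibre of `y`, and `v` kills the other rows
  have hfu : ∀ i, v i * f u i = v i * ∑ k, T i k * u k := by
    intro i
    by_cases hi : pι i = y
    · congr 1
      rw [apply_eq_sum_entry]
      refine Finset.sum_congr rfl fun k _ => ?_
      by_cases hk : pκ k = y'
      · simp [hT, hi, hk]
      · rw [hu k hk, mul_zero, mul_zero]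
    · rw [hv i hi, zero_mul, zero_mul]
  have hinner : ⟪v, f u⟫_ℝ = ∑ i, v i * ∑ k, T i k * u k := by
    rw [inner_eq_sum]
    exact Finset.sum_congr rfl fun i _ => hfu i
  -- Cauchy–Schwarz in `i`, then the Schur test for `T`
  have hCS := Finset.sum_mul_sq_le_sq_mul_sq univ (fun i => v i) (fun i => ∑ k, T i k * u k)
  have hS := sum_sq_le_abs T (fun k => u k) (by positivity : 0 ≤ Cf * E) hTrow hTcol
  have hv2 : ∑ i, (v i) ^ 2 = ‖v‖ ^ 2 := (EuclideanSpace.real_norm_sq_eq v).symm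
  have hu2 : ∑ k, (u k) ^ 2 = ‖u‖ ^ 2 := (EuclideanSpace.real_norm_sq_eq u).symm
  have hsq : ⟪v, f u⟫_ℝ ^ 2 ≤ (C * E * (‖v‖ * ‖u‖)) ^ 2 := by
    rw [hinner]
    calc (∑ i, v i * ∑ k, T i k * u k) ^ 2 ≤ (∑ i, (v i) ^ 2) * ∑ i, (∑ k, T i k * u k) ^ 2 := hCS
      _ ≤ ‖v‖ ^ 2 * (Cf * E * (Cg * E) * ∑ k, (u k) ^ 2) := by
          rw [hv2]; exact mul_le_mul_of_nonneg_left hS (sq_nonneg _)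
      _ = (Cf * Cg) * (E * (‖v‖ * ‖u‖)) ^ 2 := by rw [hu2]; ring
      _ ≤ C ^ 2 * (E * (‖v‖ * ‖u‖)) ^ 2 := mul_le_mul_of_nonneg_right hCC (sq_nonneg _)
      _ = (C * E * (‖v‖ * ‖u‖)) ^ 2 := by ring
  exact abs_le_of_sq_le_sq hsq (by positivity)

/-! ## §2  Composition, adjoint, sums of `ℓ²` block bounds -/

/-- from the `ℓ²` block bound, the norm of a fibre restriction of `gu`: `‖(gu)↾y″‖ ≤ C_g e^{−bρ(y″,y′)}‖u‖` for `u` over the fibre of `y′`.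
[cite: Balaban1984PropagatorsII, Prop. 2.5 p.246 (the «(2.129) ⇒ (1.114)» step; ours)] -/
theorem norm_restrict_apply_le [DecidableEq Y] (g : EuclideanSpace ℝ μ →ₗ[ℝ] EuclideanSpace ℝ κ) (pκ : κ → Y) (pμ : μ → Y) {Cg b : ℝ} (hCg : 0 ≤ Cg)
    (hg : ∀ (y y' : Y) (v : EuclideanSpace ℝ κ) (u : EuclideanSpace ℝ μ), (∀ k, pκ k ≠ y → v k = 0) → (∀ m, pμ m ≠ y' → u m = 0) →
      |⟪v, g u⟫_ℝ| ≤ Cg * Real.exp (-(b * ρ y y')) * (‖v‖ * ‖u‖))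
    (y'' y' : Y) (u : EuclideanSpace ℝ μ) (hu : ∀ m, pμ m ≠ y' → u m = 0) :
    ‖(WithLp.toLp 2 (fun k => if pκ k = y'' then g u k else 0) : EuclideanSpace ℝ κ)‖ ≤ Cg * Real.exp (-(b * ρ y'' y')) * ‖u‖ := by
  set w : EuclideanSpace ℝ κ := WithLp.toLp 2 (fun k => if pκ k = y'' then g u k else 0) with hw
  have hsupp : ∀ k, pκ k ≠ y'' → w k = 0 := fun k hk => restrict_apply_of_ne pκ (g u) y'' k hk
  -- `‖w‖² = ⟨w, gu⟩`
  have hww : ‖w‖ ^ 2 = ⟪w, g u⟫_ℝ := by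
    rw [← real_inner_self_eq_norm_sq, hw]
    exact (inner_restrict_left_eq pκ (g u) (g u) y'').symm
  have h := hg y'' y' w u hsupp hu
  have h1 : ‖w‖ ^ 2 ≤ Cg * Real.exp (-(b * ρ y'' y')) * ‖u‖ * ‖w‖ := by
    rw [hww]; exact (le_abs_self _).trans (by linarith [h])
  by_cases hw0 : ‖w‖ = 0
  · rw [hw0]; positivity
  · have hwpos : 0 < ‖w‖ := lt_of_le_of_ne (norm_nonneg _) (Ne.symm hw0)
    rw [pow_two] at h1
    exact le_of_mul_le_mul_right h1 hwpos

/-- **COMPOSITION OF `ℓ²` BLOCK BOUNDS, NO VOLUME FACTOR**: `(C_f, a)` for `f : ℓ²(κ) → ℓ²(ι)` and `(C_g, b)` for `g : ℓ²(μ) → ℓ²(κ)` give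
`(C_f·C_g·K(a − δ′), δ′)` for `f∘g`, for every `0 ≤ δ′ ≤ b`, `δ′ < a`: `⟨v, fgu⟩ = Σ_{y″}⟨v, f((gu)↾y″)⟩` and the lattice convolution of file 2.
[cite: Balaban1984PropagatorsII, Prop. 2.5 p.246 (the «(2.129) ⇒ (1.114)» step; statement and proof ours)] -/
theorem l2blk_comp [Fintype Y] (hρ : IsPseudoDist ρ) (hK : SumBound ρ KY) (f : EuclideanSpace ℝ κ →ₗ[ℝ] EuclideanSpace ℝ ι)
    (g : EuclideanSpace ℝ μ →ₗ[ℝ] EuclideanSpace ℝ κ) (pι : ι → Y) (pκ : κ → Y) (pμ : μ → Y) {Cf Cg a b δ' : ℝ} (hCf : 0 ≤ Cf) (hCg : 0 ≤ Cg)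
    (hδ'0 : 0 ≤ δ') (hδ'b : δ' ≤ b) (hδ'a : δ' < a)
    (hf : ∀ (y y' : Y) (v : EuclideanSpace ℝ ι) (u : EuclideanSpace ℝ κ), (∀ i, pι i ≠ y → v i = 0) → (∀ k, pκ k ≠ y' → u k = 0) →
      |⟪v, f u⟫_ℝ| ≤ Cf * Real.exp (-(a * ρ y y')) * (‖v‖ * ‖u‖))
    (hg : ∀ (y y' : Y) (v : EuclideanSpace ℝ κ) (u : EuclideanSpace ℝ μ), (∀ k, pκ k ≠ y → v k = 0) → (∀ m, pμ m ≠ y' → u m = 0) →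
      |⟪v, g u⟫_ℝ| ≤ Cg * Real.exp (-(b * ρ y y')) * (‖v‖ * ‖u‖))
    (y y' : Y) (v : EuclideanSpace ℝ ι) (u : EuclideanSpace ℝ μ) (hv : ∀ i, pι i ≠ y → v i = 0) (hu : ∀ m, pμ m ≠ y' → u m = 0) :
    |⟪v, (f ∘ₗ g) u⟫_ℝ| ≤ Cf * Cg * KY (a - δ') * Real.exp (-(δ' * ρ y y')) * (‖v‖ * ‖u‖) := by
  classical
  -- `gu = Σ_{y″} (gu)↾y″`
  have hdec : (f ∘ₗ g) u = ∑ y'', f (WithLp.toLp 2 (fun k => if pκ k = y'' then g u k else 0) : EuclideanSpace ℝ κ) := by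
    rw [LinearMap.comp_apply, ← map_sum, sum_restrict_eq]
  rw [hdec, inner_sum]
  have hterm : ∀ y'', |⟪v, f (WithLp.toLp 2 (fun k => if pκ k = y'' then g u k else 0) : EuclideanSpace ℝ κ)⟫_ℝ| ≤
      Cf * Real.exp (-(a * ρ y y'')) * (‖v‖ * (Cg * Real.exp (-(b * ρ y'' y')) * ‖u‖)) := by
    intro y''
    have h1 := hf y y'' v (WithLp.toLp 2 (fun k => if pκ k = y'' then g u k else 0) : EuclideanSpace ℝ κ) hv
      (fun k hk => restrict_apply_of_ne pκ (g u) y'' k hk)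
    have h2 := norm_restrict_apply_le g pκ pμ hCg hg y'' y' u hu
    exact h1.trans (mul_le_mul_of_nonneg_left (mul_le_mul_of_nonneg_left h2 (norm_nonneg _)) (by positivity))
  calc |∑ y'', ⟪v, f (WithLp.toLp 2 (fun k => if pκ k = y'' then g u k else 0) : EuclideanSpace ℝ κ)⟫_ℝ|
      ≤ ∑ y'', |⟪v, f (WithLp.toLp 2 (fun k => if pκ k = y'' then g u k else 0) : EuclideanSpace ℝ κ)⟫_ℝ| := Finset.abs_sum_le_sum_abs _ _
    _ ≤ ∑ y'', Cf * Real.exp (-(a * ρ y y'')) * (‖v‖ * (Cg * Real.exp (-(b * ρ y'' y')) * ‖u‖)) := Finset.sum_le_sum fun y'' _ => hterm y''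
    _ = Cf * Cg * (‖v‖ * ‖u‖) * ∑ y'', Real.exp (-(a * ρ y y'')) * Real.exp (-(b * ρ y'' y')) := by
        rw [Finset.mul_sum]; exact Finset.sum_congr rfl fun y'' _ => by ring
    _ ≤ Cf * Cg * (‖v‖ * ‖u‖) * (KY (a - δ') * Real.exp (-(δ' * ρ y y'))) :=
        mul_le_mul_of_nonneg_left (conv_exp_le_rate hρ hK hδ'0 hδ'b hδ'a y y') (by positivity)
    _ = _ := by ring

/-- **THE ADJOINT HAS THE SAME `ℓ²` BLOCK BOUND** (with the position maps exchanged): `⟨u, f*v⟩ = ⟨v, fu⟩` and `ρ` is symmetric.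
[cite: Balaban1984PropagatorsII, Prop. 2.5 p.246 (ours)] -/
theorem l2blk_adjoint (hρ : IsPseudoDist ρ) (f : EuclideanSpace ℝ κ →ₗ[ℝ] EuclideanSpace ℝ ι) (pι : ι → Y) (pκ : κ → Y) {C δ : ℝ}
    (hf : ∀ (y y' : Y) (v : EuclideanSpace ℝ ι) (u : EuclideanSpace ℝ κ), (∀ i, pι i ≠ y → v i = 0) → (∀ k, pκ k ≠ y' → u k = 0) →
      |⟪v, f u⟫_ℝ| ≤ C * Real.exp (-(δ * ρ y y')) * (‖v‖ * ‖u‖))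
    (y y' : Y) (u : EuclideanSpace ℝ κ) (v : EuclideanSpace ℝ ι) (hu : ∀ k, pκ k ≠ y → u k = 0) (hv : ∀ i, pι i ≠ y' → v i = 0) :
    |⟪u, LinearMap.adjoint f v⟫_ℝ| ≤ C * Real.exp (-(δ * ρ y y')) * (‖u‖ * ‖v‖) := by
  rw [LinearMap.adjoint_inner_right, real_inner_comm, hρ.symm, mul_comm ‖u‖]
  exact hf y' y v u hv hu

/-- `ℓ²` block bounds ADD: `(C_f + C_g, δ)` for `f + g`. [cite: Balaban1984PropagatorsII, Prop. 2.5 p.246 (ours)] -/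
theorem l2blk_add (f g : EuclideanSpace ℝ κ →ₗ[ℝ] EuclideanSpace ℝ ι) (pι : ι → Y) (pκ : κ → Y) {Cf Cg δ : ℝ}
    (hf : ∀ (y y' : Y) (v : EuclideanSpace ℝ ι) (u : EuclideanSpace ℝ κ), (∀ i, pι i ≠ y → v i = 0) → (∀ k, pκ k ≠ y' → u k = 0) →
      |⟪v, f u⟫_ℝ| ≤ Cf * Real.exp (-(δ * ρ y y')) * (‖v‖ * ‖u‖))
    (hg : ∀ (y y' : Y) (v : EuclideanSpace ℝ ι) (u : EuclideanSpace ℝ κ), (∀ i, pι i ≠ y → v i = 0) → (∀ k, pκ k ≠ y' → u k = 0) →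
      |⟪v, g u⟫_ℝ| ≤ Cg * Real.exp (-(δ * ρ y y')) * (‖v‖ * ‖u‖))
    (y y' : Y) (v : EuclideanSpace ℝ ι) (u : EuclideanSpace ℝ κ) (hv : ∀ i, pι i ≠ y → v i = 0) (hu : ∀ k, pκ k ≠ y' → u k = 0) :
    |⟪v, (f + g) u⟫_ℝ| ≤ (Cf + Cg) * Real.exp (-(δ * ρ y y')) * (‖v‖ * ‖u‖) := by
  rw [LinearMap.add_apply, inner_add_right, add_mul, add_mul]
  exact (abs_add_le _ _).trans (add_le_add (hf y y' v u hv hu) (hg y y' v u hv hu))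

/-- `ℓ²` block bounds SUBTRACT: `(C_f + C_g, δ)` for `f − g`. [cite: Balaban1984PropagatorsII, Prop. 2.5 p.246 (ours)] -/
theorem l2blk_sub (f g : EuclideanSpace ℝ κ →ₗ[ℝ] EuclideanSpace ℝ ι) (pι : ι → Y) (pκ : κ → Y) {Cf Cg δ : ℝ}
    (hf : ∀ (y y' : Y) (v : EuclideanSpace ℝ ι) (u : EuclideanSpace ℝ κ), (∀ i, pι i ≠ y → v i = 0) → (∀ k, pκ k ≠ y' → u k = 0) →
      |⟪v, f u⟫_ℝ| ≤ Cf * Real.exp (-(δ * ρ y y')) * (‖v‖ * ‖u‖))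
    (hg : ∀ (y y' : Y) (v : EuclideanSpace ℝ ι) (u : EuclideanSpace ℝ κ), (∀ i, pι i ≠ y → v i = 0) → (∀ k, pκ k ≠ y' → u k = 0) →
      |⟪v, g u⟫_ℝ| ≤ Cg * Real.exp (-(δ * ρ y y')) * (‖v‖ * ‖u‖))
    (y y' : Y) (v : EuclideanSpace ℝ ι) (u : EuclideanSpace ℝ κ) (hv : ∀ i, pι i ≠ y → v i = 0) (hu : ∀ k, pκ k ≠ y' → u k = 0) :
    |⟪v, (f - g) u⟫_ℝ| ≤ (Cf + Cg) * Real.exp (-(δ * ρ y y')) * (‖v‖ * ‖u‖) := by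
  rw [LinearMap.sub_apply, inner_sub_right, add_mul, add_mul]
  exact (abs_sub _ _).trans (add_le_add (hf y y' v u hv hu) (hg y y' v u hv hu))

/-- `ℓ²` block bounds SCALE: `(|c|C_f, δ)` for `c·f`. [cite: Balaban1984PropagatorsII, Prop. 2.5 p.246 (ours)] -/
theorem l2blk_smul (f : EuclideanSpace ℝ κ →ₗ[ℝ] EuclideanSpace ℝ ι) (pι : ι → Y) (pκ : κ → Y) {Cf δ : ℝ} (c : ℝ)
    (hf : ∀ (y y' : Y) (v : EuclideanSpace ℝ ι) (u : EuclideanSpace ℝ κ), (∀ i, pι i ≠ y → v i = 0) → (∀ k, pκ k ≠ y' → u k = 0) →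
      |⟪v, f u⟫_ℝ| ≤ Cf * Real.exp (-(δ * ρ y y')) * (‖v‖ * ‖u‖))
    (y y' : Y) (v : EuclideanSpace ℝ ι) (u : EuclideanSpace ℝ κ) (hv : ∀ i, pι i ≠ y → v i = 0) (hu : ∀ k, pκ k ≠ y' → u k = 0) :
    |⟪v, (c • f) u⟫_ℝ| ≤ |c| * Cf * Real.exp (-(δ * ρ y y')) * (‖v‖ * ‖u‖) := by
  rw [LinearMap.smul_apply, real_inner_smul_right, abs_mul, mul_assoc |c|, mul_assoc |c|]
  exact mul_le_mul_of_nonneg_left (hf y y' v u hv hu) (abs_nonneg c)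

/-- `ℓ²` block bounds are MONOTONE in the constant and ANTITONE in the rate. [cite: Balaban1984PropagatorsII, Prop. 2.5 p.246 (ours)] -/
theorem l2blk_mono (hρ : IsPseudoDist ρ) (f : EuclideanSpace ℝ κ →ₗ[ℝ] EuclideanSpace ℝ ι) (pι : ι → Y) (pκ : κ → Y) {C C' δ δ' : ℝ}
    (hC' : 0 ≤ C') (hCC : C ≤ C') (hδδ : δ' ≤ δ)
    (hf : ∀ (y y' : Y) (v : EuclideanSpace ℝ ι) (u : EuclideanSpace ℝ κ), (∀ i, pι i ≠ y → v i = 0) → (∀ k, pκ k ≠ y' → u k = 0) →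
      |⟪v, f u⟫_ℝ| ≤ C * Real.exp (-(δ * ρ y y')) * (‖v‖ * ‖u‖))
    (y y' : Y) (v : EuclideanSpace ℝ ι) (u : EuclideanSpace ℝ κ) (hv : ∀ i, pι i ≠ y → v i = 0) (hu : ∀ k, pκ k ≠ y' → u k = 0) :
    |⟪v, f u⟫_ℝ| ≤ C' * Real.exp (-(δ' * ρ y y')) * (‖v‖ * ‖u‖) := by
  refine (hf y y' v u hv hu).trans ?_
  have h1 : Real.exp (-(δ * ρ y y')) ≤ Real.exp (-(δ' * ρ y y')) := Real.exp_le_exp.2 (by nlinarith [hρ.nonneg y y'])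
  exact mul_le_mul_of_nonneg_right ((mul_le_mul_of_nonneg_right hCC (Real.exp_pos _).le).trans (mul_le_mul_of_nonneg_left h1 hC'))
    (by positivity)

/-- the IDENTITY has the `ℓ²` block bound `(1, δ)` for every `δ`: distinct fibres are orthogonal. [cite: Balaban1984PropagatorsII, Prop. 2.5 p.246 (ours)] -/
theorem l2blk_id (hρ : IsPseudoDist ρ) (pι : ι → Y) (δ : ℝ) (y y' : Y) (v u : EuclideanSpace ℝ ι)
    (hv : ∀ i, pι i ≠ y → v i = 0) (hu : ∀ i, pι i ≠ y' → u i = 0) :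
    |⟪v, (LinearMap.id : EuclideanSpace ℝ ι →ₗ[ℝ] EuclideanSpace ℝ ι) u⟫_ℝ| ≤ 1 * Real.exp (-(δ * ρ y y')) * (‖v‖ * ‖u‖) := by
  rw [LinearMap.id_apply]
  by_cases hyy : y = y'
  · subst hyy
    rw [hρ.zero, mul_zero, neg_zero, Real.exp_zero, one_mul, one_mul]
    exact abs_real_inner_le_norm v u
  · have h0 : ⟪v, u⟫_ℝ = 0 := by
      rw [inner_eq_sum]
      refine Finset.sum_eq_zero fun i _ => ?_
      by_cases hi : pι i = y
      · rw [hu i (by rw [hi]; exact hyy), mul_zero]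
      · rw [hv i hi, zero_mul]
    rw [h0, abs_zero]
    positivity

/-! ## §3  The shape of (1.114): `ℓ²` bounds between balls, cut-off `ℓ²` norms -/

/-- two points of the two balls: `ρ(y₁,y) ≤ r`, `ρ(y₂,y′) ≤ r`, `δ ≥ 0` ⇒ `e^{−δρ(y₁,y₂)} ≤ e^{2δr}e^{−δρ(y,y′)}`.
[cite: Balaban1984PropagatorsI, (1.114) p.36 (bookkeeping, ours)] -/
theorem exp_neg_le_of_mem_balls (hρ : IsPseudoDist ρ) {δ r : ℝ} (hδ : 0 ≤ δ) {y y' y₁ y₂ : Y} (hy₁ : ρ y₁ y ≤ r) (hy₂ : ρ y₂ y' ≤ r) :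
    Real.exp (-(δ * ρ y₁ y₂)) ≤ Real.exp (2 * δ * r) * Real.exp (-(δ * ρ y y')) := by
  rw [← Real.exp_add]
  apply Real.exp_le_exp.2
  have t1 := hρ.triangle y y₁ y'
  have t2 := hρ.triangle y₁ y₂ y'
  rw [hρ.symm y y₁] at t1
  nlinarith [mul_le_mul_of_nonneg_left t1 hδ, mul_le_mul_of_nonneg_left t2 hδ, mul_le_mul_of_nonneg_left hy₁ hδ,
    mul_le_mul_of_nonneg_left hy₂ hδ, hρ.nonneg y₁ y₂]

/-- `Σ_y ‖x↾y‖ ≤ √#S·‖x‖` when the fibre restrictions of `x` vanish outside `S` (Cauchy–Schwarz over `S`, `Σ_y ‖x↾y‖² = ‖x‖²`).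
[cite: Balaban1984PropagatorsI, (1.114) p.36 (bookkeeping, ours)] -/
theorem sum_norm_restrict_le_sqrt_card [Fintype Y] [DecidableEq Y] (pκ : κ → Y) (x : EuclideanSpace ℝ κ) (S : Finset Y)
    (hx : ∀ y, y ∉ S → (WithLp.toLp 2 (fun k => if pκ k = y then x k else 0) : EuclideanSpace ℝ κ) = 0) :
    ∑ y, ‖(WithLp.toLp 2 (fun k => if pκ k = y then x k else 0) : EuclideanSpace ℝ κ)‖ ≤ Real.sqrt S.card * ‖x‖ := by
  have hz : ∑ y ∈ S, ‖(WithLp.toLp 2 (fun k => if pκ k = y then x k else 0) : EuclideanSpace ℝ κ)‖ =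
      ∑ y, ‖(WithLp.toLp 2 (fun k => if pκ k = y then x k else 0) : EuclideanSpace ℝ κ)‖ :=
    Finset.sum_subset (Finset.subset_univ S) fun y _ hy => by rw [hx y hy, norm_zero]
  have hsq : ∑ y ∈ S, ‖(WithLp.toLp 2 (fun k => if pκ k = y then x k else 0) : EuclideanSpace ℝ κ)‖ ^ 2 ≤ ‖x‖ ^ 2 := by
    rw [← sum_norm_restrict_sq pκ x]
    exact Finset.sum_le_sum_of_subset_of_nonneg (Finset.subset_univ S) fun _ _ _ => sq_nonneg _
  have hone : ∑ _y ∈ S, (1 : ℝ) ^ 2 = S.card := by rw [Finset.sum_const, one_pow, nsmul_eq_mul, mul_one]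
  have hcs := Finset.sum_mul_sq_le_sq_mul_sq S (fun y => ‖(WithLp.toLp 2 (fun k => if pκ k = y then x k else 0) : EuclideanSpace ℝ κ)‖)
    (fun _ => (1 : ℝ))
  have h1 : (∑ y ∈ S, ‖(WithLp.toLp 2 (fun k => if pκ k = y then x k else 0) : EuclideanSpace ℝ κ)‖ * 1) ^ 2 ≤
      (Real.sqrt S.card * ‖x‖) ^ 2 := by
    refine hcs.trans ?_
    rw [hone, mul_pow, Real.sq_sqrt (Nat.cast_nonneg _), mul_comm]
    exact mul_le_mul_of_nonneg_left hsq (Nat.cast_nonneg _)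
  have h2 := (le_abs_self _).trans (abs_le_of_sq_le_sq h1 (by positivity))
  rw [← hz]
  simpa only [mul_one] using h2

/-- **`ℓ²` BLOCK BOUND ⇒ `ℓ²` BOUND BETWEEN BALLS**: if `f` has the `ℓ²` block bound `(C, δ)` (`C, δ ≥ 0`), `v` is supported over the points within
`r` of `y` and `u` over those within `r` of `y′`, then `|⟨v, fu⟩| ≤ C·K(1)e^{(1+2δ)r}·e^{−δρ(y,y′)}‖v‖‖u‖` — both vectors decomposed over the fibres in
the balls, each pair bounded by the block bound and `e^{−δρ(y₁,y₂)} ≤ e^{2δr}e^{−δρ(y,y′)}`, then Cauchy–Schwarz over the balls (`#ball ≤ e^{r}K(1)`,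
file 2's `card_ball_le`). [cite: Balaban1984PropagatorsI, (1.114) p.36 (shape; derivation ours); Balaban1984PropagatorsII, Prop. 2.5 p.246] -/
theorem abs_inner_le_of_l2blk_balls [Fintype Y] (hρ : IsPseudoDist ρ) (hK : SumBound ρ KY)
    (f : EuclideanSpace ℝ κ →ₗ[ℝ] EuclideanSpace ℝ ι) (pι : ι → Y) (pκ : κ → Y) {C δ r : ℝ} (hC : 0 ≤ C) (hδ : 0 ≤ δ)
    (hf : ∀ (y y' : Y) (v : EuclideanSpace ℝ ι) (u : EuclideanSpace ℝ κ), (∀ i, pι i ≠ y → v i = 0) → (∀ k, pκ k ≠ y' → u k = 0) →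
      |⟪v, f u⟫_ℝ| ≤ C * Real.exp (-(δ * ρ y y')) * (‖v‖ * ‖u‖))
    (y y' : Y) (v : EuclideanSpace ℝ ι) (u : EuclideanSpace ℝ κ) (hv : ∀ i, v i ≠ 0 → ρ (pι i) y ≤ r) (hu : ∀ k, u k ≠ 0 → ρ (pκ k) y' ≤ r) :
    |⟪v, f u⟫_ℝ| ≤ C * (KY 1 * Real.exp ((1 + 2 * δ) * r)) * Real.exp (-(δ * ρ y y')) * (‖v‖ * ‖u‖) := by
  classical
  -- fibre decompositions
  set vv : Y → EuclideanSpace ℝ ι := fun y₁ => WithLp.toLp 2 (fun i => if pι i = y₁ then v i else 0) with hvv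
  set uu : Y → EuclideanSpace ℝ κ := fun y₂ => WithLp.toLp 2 (fun k => if pκ k = y₂ then u k else 0) with huu
  have hvsum : ∑ y₁, vv y₁ = v := sum_restrict_eq pι v
  have husum : ∑ y₂, uu y₂ = u := sum_restrict_eq pκ u
  have hvv_supp : ∀ y₁ i, pι i ≠ y₁ → vv y₁ i = 0 := fun y₁ i hi => restrict_apply_of_ne pι v y₁ i hi
  have huu_supp : ∀ y₂ k, pκ k ≠ y₂ → uu y₂ k = 0 := fun y₂ k hk => restrict_apply_of_ne pκ u y₂ k hk
  -- the restrictions vanish outside the balls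
  have hvv_zero : ∀ y₁, y₁ ∉ univ.filter (fun y₁ => ρ y₁ y ≤ r) → vv y₁ = 0 := by
    intro y₁ hy₁
    have hy₁' : ¬ ρ y₁ y ≤ r := fun h => hy₁ (Finset.mem_filter.2 ⟨Finset.mem_univ _, h⟩)
    apply PiLp.ext
    intro i
    show (if pι i = y₁ then v i else 0) = 0
    by_cases hi : pι i = y₁
    · rw [if_pos hi]
      by_contra hne
      exact hy₁' (hi ▸ hv i hne)
    · rw [if_neg hi]
  have huu_zero : ∀ y₂, y₂ ∉ univ.filter (fun y₂ => ρ y₂ y' ≤ r) → uu y₂ = 0 := by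
    intro y₂ hy₂
    have hy₂' : ¬ ρ y₂ y' ≤ r := fun h => hy₂ (Finset.mem_filter.2 ⟨Finset.mem_univ _, h⟩)
    apply PiLp.ext
    intro k
    show (if pκ k = y₂ then u k else 0) = 0
    by_cases hk : pκ k = y₂
    · rw [if_pos hk]
      by_contra hne
      exact hy₂' (hk ▸ hu k hne)
    · rw [if_neg hk]
  -- each pair of fibres: the block bound inside the balls, zero outside
  set E : ℝ := Real.exp (2 * δ * r) * Real.exp (-(δ * ρ y y')) with hE
  have hE0 : 0 ≤ E := by positivity
  have hpair : ∀ y₁ y₂, |⟪vv y₁, f (uu y₂)⟫_ℝ| ≤ C * E * (‖vv y₁‖ * ‖uu y₂‖) := by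
    intro y₁ y₂
    by_cases hy₁ : ρ y₁ y ≤ r
    · by_cases hy₂ : ρ y₂ y' ≤ r
      · exact (hf y₁ y₂ (vv y₁) (uu y₂) (hvv_supp y₁) (huu_supp y₂)).trans
          (mul_le_mul_of_nonneg_right (mul_le_mul_of_nonneg_left (exp_neg_le_of_mem_balls hρ hδ hy₁ hy₂) hC) (by positivity))
      · have h0 : uu y₂ = 0 := huu_zero y₂ fun h => hy₂ (Finset.mem_filter.1 h).2
        rw [h0, map_zero, inner_zero_right, abs_zero]
        positivity
    · have h0 : vv y₁ = 0 := hvv_zero y₁ fun h => hy₁ (Finset.mem_filter.1 h).2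
      rw [h0, inner_zero_left, abs_zero]
      positivity
  have hinner : ⟪v, f u⟫_ℝ = ∑ y₁, ∑ y₂, ⟪vv y₁, f (uu y₂)⟫_ℝ := by
    rw [← hvsum, sum_inner]
    refine Finset.sum_congr rfl fun y₁ _ => ?_
    conv_lhs => rw [← husum]
    rw [map_sum, inner_sum]
  -- Cauchy–Schwarz over the balls
  have hK1 : 0 ≤ KY 1 := le_trans (Finset.sum_nonneg fun _ _ => (Real.exp_pos _).le) (hK 1 one_pos y)
  have hsum₁ : ∑ y₁, ‖vv y₁‖ ≤ Real.sqrt ((univ.filter fun y₁ => ρ y₁ y ≤ r).card : ℝ) * ‖v‖ :=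
    sum_norm_restrict_le_sqrt_card pι v _ hvv_zero
  have hsum₂ : ∑ y₂, ‖uu y₂‖ ≤ Real.sqrt ((univ.filter fun y₂ => ρ y₂ y' ≤ r).card : ℝ) * ‖u‖ :=
    sum_norm_restrict_le_sqrt_card pκ u _ huu_zero
  have hBB : Real.sqrt ((univ.filter fun y₁ => ρ y₁ y ≤ r).card : ℝ) * Real.sqrt ((univ.filter fun y₂ => ρ y₂ y' ≤ r).card : ℝ) ≤
      Real.exp r * KY 1 := by
    have hRK : 0 ≤ Real.exp r * KY 1 := mul_nonneg (Real.exp_pos _).le hK1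
    calc Real.sqrt ((univ.filter fun y₁ => ρ y₁ y ≤ r).card : ℝ) * Real.sqrt ((univ.filter fun y₂ => ρ y₂ y' ≤ r).card : ℝ)
        ≤ Real.sqrt (Real.exp r * KY 1) * Real.sqrt (Real.exp r * KY 1) :=
          mul_le_mul (Real.sqrt_le_sqrt (card_ball_le hρ hK y r)) (Real.sqrt_le_sqrt (card_ball_le hρ hK y' r)) (Real.sqrt_nonneg _)
            (Real.sqrt_nonneg _)
      _ = Real.exp r * KY 1 := Real.mul_self_sqrt hRK
  have h2 : Real.exp ((1 + 2 * δ) * r) = Real.exp r * Real.exp (2 * δ * r) := by rw [← Real.exp_add]; ring_nf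
  rw [hinner]
  calc |∑ y₁, ∑ y₂, ⟪vv y₁, f (uu y₂)⟫_ℝ| ≤ ∑ y₁, |∑ y₂, ⟪vv y₁, f (uu y₂)⟫_ℝ| := Finset.abs_sum_le_sum_abs _ _
    _ ≤ ∑ y₁, ∑ y₂, |⟪vv y₁, f (uu y₂)⟫_ℝ| := Finset.sum_le_sum fun y₁ _ => Finset.abs_sum_le_sum_abs _ _
    _ ≤ ∑ y₁, ∑ y₂, C * E * (‖vv y₁‖ * ‖uu y₂‖) := Finset.sum_le_sum fun y₁ _ => Finset.sum_le_sum fun y₂ _ => hpair y₁ y₂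
    _ = C * E * ((∑ y₁, ‖vv y₁‖) * ∑ y₂, ‖uu y₂‖) := by
        rw [Finset.sum_mul_sum, Finset.mul_sum]
        refine Finset.sum_congr rfl fun y₁ _ => ?_
        rw [Finset.mul_sum]
    _ ≤ C * E * ((Real.sqrt ((univ.filter fun y₁ => ρ y₁ y ≤ r).card : ℝ) * ‖v‖) *
          (Real.sqrt ((univ.filter fun y₂ => ρ y₂ y' ≤ r).card : ℝ) * ‖u‖)) :=
        mul_le_mul_of_nonneg_left (mul_le_mul hsum₁ hsum₂ (Finset.sum_nonneg fun _ _ => norm_nonneg _) (by positivity)) (mul_nonneg hC hE0)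
    _ = C * E * (Real.sqrt ((univ.filter fun y₁ => ρ y₁ y ≤ r).card : ℝ) * Real.sqrt ((univ.filter fun y₂ => ρ y₂ y' ≤ r).card : ℝ)) *
          (‖v‖ * ‖u‖) := by ring
    _ ≤ C * E * (Real.exp r * KY 1) * (‖v‖ * ‖u‖) :=
        mul_le_mul_of_nonneg_right (mul_le_mul_of_nonneg_left hBB (mul_nonneg hC hE0)) (by positivity)
    _ = C * (KY 1 * Real.exp ((1 + 2 * δ) * r)) * Real.exp (-(δ * ρ y y')) * (‖v‖ * ‖u‖) := by rw [hE, h2]; ring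

/-- **`ℓ²` BLOCK BOUND ⇒ THE SHAPE OF (1.114)**: if `f` has the `ℓ²` block bound `(C, δ)` (`C, δ ≥ 0`), `J` is supported over the points within `r` of
`y′`, the cut-off `ζ` is supported over the points within `r` of `y` and `|ζ| ≤ Z`, then
`Σ_i (ζ_i·(fJ)_i)² ≤ (C·K(1)e^{(1+2δ)r}·e^{−δρ(y,y′)}·Z)²·‖J‖²`, i.e. `‖ζfJ‖ ≤ C·K(1)e^{(1+2δ)r}·e^{−δρ(y,y′)}·Z·‖J‖` — `‖ζfJ‖² = ⟨ζ²fJ, fJ⟩`, the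
bound between balls, `‖ζ²fJ‖ ≤ Z‖ζfJ‖`. [cite: Balaban1984PropagatorsI, (1.114) p.36 (shape; derivation ours); Balaban1984PropagatorsII, Prop. 2.5 p.246] -/
theorem normSq_cut_apply_le_of_l2blk [Fintype Y] (hρ : IsPseudoDist ρ) (hK : SumBound ρ KY)
    (f : EuclideanSpace ℝ κ →ₗ[ℝ] EuclideanSpace ℝ ι) (pι : ι → Y) (pκ : κ → Y) {C δ r Z : ℝ} (hC : 0 ≤ C) (hδ : 0 ≤ δ) (hZ : 0 ≤ Z)
    (hf : ∀ (y y' : Y) (v : EuclideanSpace ℝ ι) (u : EuclideanSpace ℝ κ), (∀ i, pι i ≠ y → v i = 0) → (∀ k, pκ k ≠ y' → u k = 0) →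
      |⟪v, f u⟫_ℝ| ≤ C * Real.exp (-(δ * ρ y y')) * (‖v‖ * ‖u‖))
    (J : EuclideanSpace ℝ κ) (ζ : ι → ℝ) (y y' : Y)
    (hsuppJ : ∀ k, J k ≠ 0 → ρ (pκ k) y' ≤ r) (hsuppζ : ∀ i, ζ i ≠ 0 → ρ (pι i) y ≤ r) (hζ : ∀ i, |ζ i| ≤ Z) :
    ∑ i, (ζ i * f J i) ^ 2 ≤ (C * (KY 1 * Real.exp ((1 + 2 * δ) * r)) * Real.exp (-(δ * ρ y y')) * Z) ^ 2 * ‖J‖ ^ 2 := by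
  -- the vectors `w = ζ·fJ` and `v = ζ²·fJ`
  set w : EuclideanSpace ℝ ι := WithLp.toLp 2 (fun i => ζ i * f J i) with hw
  set v : EuclideanSpace ℝ ι := WithLp.toLp 2 (fun i => ζ i ^ 2 * f J i) with hv
  have hwi : ∀ i, w i = ζ i * f J i := fun i => rfl
  have hvi : ∀ i, v i = ζ i ^ 2 * f J i := fun i => rfl
  have hgoal : ∑ i, (ζ i * f J i) ^ 2 = ‖w‖ ^ 2 := by rw [EuclideanSpace.real_norm_sq_eq]
  have hww : ‖w‖ ^ 2 = ⟪v, f J⟫_ℝ := by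
    rw [EuclideanSpace.real_norm_sq_eq, inner_eq_sum]
    exact Finset.sum_congr rfl fun i _ => by rw [hwi, hvi]; ring
  have hvw : ‖v‖ ≤ Z * ‖w‖ := by
    have h2 : ‖v‖ ^ 2 ≤ (Z * ‖w‖) ^ 2 := by
      rw [mul_pow, EuclideanSpace.real_norm_sq_eq, EuclideanSpace.real_norm_sq_eq, Finset.mul_sum]
      refine Finset.sum_le_sum fun i _ => ?_
      rw [hvi, hwi]
      have h3 : (ζ i) ^ 2 ≤ Z ^ 2 := by
        rw [← sq_abs]; exact pow_le_pow_left₀ (abs_nonneg _) (hζ i) 2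
      nlinarith [sq_nonneg (ζ i * f J i)]
    have h3 := abs_le_of_sq_le_sq h2 (by positivity)
    rwa [abs_of_nonneg (norm_nonneg v)] at h3
  have hvsupp : ∀ i, v i ≠ 0 → ρ (pι i) y ≤ r := by
    intro i hne
    refine hsuppζ i fun h0 => hne ?_
    rw [hvi, h0]; ring
  -- the bound between balls for `⟨v, fJ⟩`
  have hK1 : 0 ≤ KY 1 := le_trans (Finset.sum_nonneg fun _ _ => (Real.exp_pos _).le) (hK 1 one_pos y)
  have h := abs_inner_le_of_l2blk_balls hρ hK f pι pκ hC hδ hf y y' v J hvsupp hsuppJ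
  set C' : ℝ := C * (KY 1 * Real.exp ((1 + 2 * δ) * r)) * Real.exp (-(δ * ρ y y')) with hC'
  have hC'0 : 0 ≤ C' := mul_nonneg (mul_nonneg hC (mul_nonneg hK1 (Real.exp_pos _).le)) (Real.exp_pos _).le
  have hmain : ‖w‖ ^ 2 ≤ C' * Z * ‖J‖ * ‖w‖ := by
    rw [hww]
    calc ⟪v, f J⟫_ℝ ≤ |⟪v, f J⟫_ℝ| := le_abs_self _
      _ ≤ C' * (‖v‖ * ‖J‖) := h
      _ ≤ C' * ((Z * ‖w‖) * ‖J‖) := mul_le_mul_of_nonneg_left (mul_le_mul_of_nonneg_right hvw (norm_nonneg _)) hC'0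
      _ = C' * Z * ‖J‖ * ‖w‖ := by ring
  -- divide by `‖w‖` and square
  have hwle : ‖w‖ ≤ C' * Z * ‖J‖ := by
    by_cases hw0 : ‖w‖ = 0
    · rw [hw0]; exact mul_nonneg (mul_nonneg hC'0 hZ) (norm_nonneg _)
    · have hwpos : 0 < ‖w‖ := lt_of_le_of_ne (norm_nonneg _) (Ne.symm hw0)
      rw [pow_two] at hmain
      exact le_of_mul_le_mul_right hmain hwpos
  rw [hgoal, ← mul_pow]
  exact pow_le_pow_left₀ (norm_nonneg _) hwle 2

end Blocks

end Literature.MathematicalPhysics.QuantumFieldTheory.Balaban1983to89.B6L2BlockCalculus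

end
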